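import Literature.NumberTheory.CubicFields.FundCubicFieldCountLandauLemmas
import Literature.NumberTheory.CubicFields.ThreeTorsionMeanDecomposition
import Literature.NumberTheory.QuadraticFields.ThreeTorsionMeanProofs
import HarnessLib

/-!
# BTT §5 for (3): from the Landau–Shintani evaluation of `N^±(X, Ψ_{q²})` to the two-term count of cubic fields of fundamental discriminant

Topic `Literature/NumberTheory/CubicFields`. The named fact `btt_fundCubicFieldCount_sum`
(`ThreeTorsionMeanDecomposition.lean`; Bhargava–Taniguchi–Thorne 2023, display (3) ⟺ Thm 1.2) is
proved in BTT §5 ("Direct proof") from exactly two kinds of input: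

1. ANALYTIC (§§2.4–3 + Prop. 5.1): for the family `Ψ_{q²}` (`q` squarefree) Landau's method in the
   averaged form Thm 3.2 gives, on each dyadic block `q ∈ [Q₁, 2Q₁]` with `Q₁ ≤ X^{1/3−ε}` (where (19)
   holds), `Σ_q |N^±(X, Ψ_{q²}) − X·Res_{s=1} ξ^±(s, Ψ_{q²}) − (6/5)X^{5/6}·Res_{s=5/6} ξ^±(s, Ψ_{q²})|
   ≪ X^{3/5} (Σ_q δ₁)^{3/5} (Σ_q δ̂₁)^{2/5} ≪ X^{3/5+ε} Q₁^{1/5}` (residues `≪ q^{-2+ε}`, `≪ q^{-5/3+ε}` by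
   (13), (15), (eq:res_p2); `Σ_{q∈[Q₁,2Q₁]} δ̂₁(Ψ_{q²}) ≪ Q₁^{2+ε}` = Prop. 5.1), and the sieved first
   residues sum to the main constant (21): `Σ_q μ(q) Res_{s=1} ξ^±(s, Ψ_{q²}) = α^± Π_p(1 − 𝒜(Ψ_{p²})) +
   β Π_p(1 − ℬ(Ψ_{p²})) = (α^± + β)(6/π²)²` = `3/π²` (`−`), `2/π²` (`+`) (`α⁺ = π²/72`, `α⁻ = β = π²/24`);
2. the UNIFORMITY estimate Prop. 4.5 (tree: `btt_uniformity_sqDvd`) for the tail `E₃`,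

by the bookkeeping "(20); split at `Q`; `E₁ + E₂ + E₃ ≪ X/Q^{1−ε} + X^{3/5} Q^{1/5+ε}`; choosing
`Q = X^{1/3−ε}` … we obtain error terms of `O(X^{2/3+ε})` … an application of Propositions 4.2 and 4.3
finishes the proof". This file PROVES that bookkeeping on the tree's objects (`nonFundCount` = `N^±(X, Ψ_{q²})`,
`FundCubicFieldCountSieve.lean`; the estimates `E₁, E₂, E₃` and the exponent arithmetic at
`Q = X^{1/3−δ}` are the lemmas of `FundCubicFieldCountLandauLemmas.lean`), with input 1 as an explicit
HYPOTHESIS: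

* `LandauShintaniData s A` — input 1 for the sign `s` with sieved main constant `A`, as a hypothesis
  STRUCTURE (data `r₁, r₂` + the consumed properties: `r₁(q) ≪_η q^{-2+η}`, `Σ_q μ(q) r₁(q) = A`,
  `r₂(q) ≪_η q^{-5/3+η}`, the dyadic Landau bound). Not a vendored fact and nothing is asserted: the tree
  has no analytic theory of Shintani zeta functions — Thm 2.4, Thms 3.1–3.2, Props. 5.1–5.2 of BTT are
  not formalized; this is exactly what remains between the tree and (3).
* `abs_sum_moebius_nonFundCount_sub_le` — **the core of §5**: `LandauShintaniData s A` and
  `btt_uniformity_sqDvd` give `K` with `Σ_{q ≤ X} μ(q) N^±(X, Ψ_{q²}) = A X + K X^{5/6} + O_ε(X^{2/3+ε})`;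
* **`btt_fundCubicFieldCount_sum_of_landauShintani`** — with (20) (`sum_moebius_mul_nonFundCount`),
  `a(D) = #fields + ½` (Prop. 4.3 / `sum_locFund_shintaniCoeffReal_neg/pos`) and the count of quadratic
  fields `(3/π²)X + O(√X)` (Prop. 4.2 / `abs_card_negFundDiscrs_sub_le`): inputs 1 (both signs,
  `A = 3/π², 2/π²`) and 2 imply `btt_fundCubicFieldCount_sum` (`3/π² − 3/(2π²) = 3/(2π²)`,
  `2/π² − 3/(2π²) = 1/(2π²)`).

## References

* M. Bhargava, T. Taniguchi, F. Thorne, *Improved error estimates for the Davenport–Heilbronn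
  theorems*, Math. Ann. 389 (2024) = arXiv:2107.12819, §5 ((20), (21), `E₁, E₂, E₃`, Prop. 5.1,
  `Q = X^{1/3−ε}`), Thm 2.4 (13)–(15), Thm 3.2, Props. 4.2, 4.3, 4.5 [BhargavaTaniguchiThorne2023].
-/

noncomputable section

open Finset ArithmeticFunction
open scoped ArithmeticFunction.Moebius

namespace Literature.NumberTheory.CubicFields

open BinaryCubic RingOfForm Literature.NumberTheory.QuadraticFields Classical

/-! ### The analytic input of §5 as a hypothesis -/

/-- **The Landau–Shintani input of BTT §5 for the family `Ψ_{q²}`, sign `s`, sieved main constant `A`**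
— a HYPOTHESIS STRUCTURE (data + the properties consumed; nothing is asserted, nothing vendored): the
"residues" `r₁(q) = Res_{s=1} ξ^{sgn}(s, Ψ_{q²})`, `r₂(q) = (6/5)·Res_{s=5/6} ξ^{sgn}(s, Ψ_{q²})` of BTT
Thm 2.4 with `|r₁(q)| ≪_η q^{-2+η}`, `|r₂(q)| ≪_η q^{-5/3+η}` on squarefree `q` ((13), (15), (eq:res_p2)),
`Σ_q μ(q) r₁(q) = A` (the main constant (21)), and the output of Landau's method in the averaged form
Thm 3.2 with Prop. 5.1 on dyadic blocks `Q₁ ≤ X^{1/3−ε}` (where (19) holds): for every `ε > 0`,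
uniformly in `X ≥ 1`, `Σ_{q ∈ [Q₁, 2Q₁) sqfree} |N^s(X, Ψ_{q²}) − r₁(q) X − r₂(q) X^{5/6}| ≤ C_ε X^{3/5+ε} Q₁^{1/5}`.
The tree has no analytic theory of Shintani zeta functions (BTT Thm 2.4, Thms 3.1–3.2, Props. 5.1–5.2
are not formalized): this structure is exactly what stands between the tree and (3).
[cite: BhargavaTaniguchiThorne2023, §5 (Thm 3.2 applied to Ψ_{q²} on dyadic blocks, with Prop. 5.1, (13), (15) and (21))] -/
structure LandauShintaniData (s : ℤ) (A : ℝ) where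
  /-- `r₁(q) = Res_{s=1} ξ^{sgn}(s, Ψ_{q²})`. -/
  r₁ : ℕ → ℝ
  /-- `r₂(q) = (6/5) Res_{s=5/6} ξ^{sgn}(s, Ψ_{q²})`. -/
  r₂ : ℕ → ℝ
  /-- `r₁(q) ≪_η q^{-2+η}` on squarefree `q` ((13), (15), (eq:res_p2): `𝒜, ℬ ≤ 2^{ω(q)}/q²`). -/
  abs_r₁_le : ∀ η : ℝ, 0 < η → ∃ C₁ : ℝ, ∀ q : ℕ, Squarefree q → |r₁ q| ≤ C₁ * (q : ℝ) ^ (-2 + η)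
  /-- The sieved first residues sum to the main constant: `Σ_q μ(q) r₁(q) = A` ((21)). -/
  hasSum_moebius_mul_r₁ : HasSum (fun q : ℕ => ((μ q : ℤ) : ℝ) * r₁ q) A
  /-- `r₂(q) ≪_η q^{-5/3+η}` on squarefree `q` ((13), (15), (eq:res_p2): `𝒞 ≪ 3^{ω(q)} q^{-5/3}`). -/
  abs_r₂_le : ∀ η : ℝ, 0 < η → ∃ C₂ : ℝ, ∀ q : ℕ, Squarefree q → |r₂ q| ≤ C₂ * (q : ℝ) ^ (-(5 : ℝ) / 3 + η)
  /-- Thm 3.2 + Prop. 5.1 on the dyadic block `[Q₁, 2Q₁)`, `Q₁ ≤ X^{1/3−ε}`. -/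
  landau : ∀ ε : ℝ, 0 < ε → ∃ C : ℝ, ∀ X : ℕ, 1 ≤ X → ∀ Q₁ : ℕ, 1 ≤ Q₁ → (Q₁ : ℝ) ≤ (X : ℝ) ^ ((1 : ℝ) / 3 - ε) →
    ∑ q ∈ (Finset.Ico Q₁ (2 * Q₁)).filter Squarefree,
        |nonFundCount s q X - r₁ q * X - r₂ q * (X : ℝ) ^ ((5 : ℝ) / 6)|
      ≤ C * (X : ℝ) ^ ((3 : ℝ) / 5 + ε) * (Q₁ : ℝ) ^ ((1 : ℝ) / 5)

/-! ### The core of §5: `Σ_{q ≤ X} μ(q) N^±(X, Ψ_{q²}) = A X + K X^{5/6} + O(X^{2/3+ε})` -/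

/-- **BTT §5, the direct proof, as bookkeeping**: the Landau–Shintani input for the sign `s` with main
constant `A` and the uniformity estimate (Prop. 4.5) give a constant `K = Σ_q μ(q) r₂(q)` (the sieved
secondary residues) such that for every `ε > 0`,
`|Σ_{1 ≤ q ≤ X} μ(q) N^s(X, Ψ_{q²}) − A X − K X^{5/6}| ≤ C_ε X^{2/3+ε}` for all `X ≥ 1`
("`E₁ + E₂ + E₃ ≪ X/Q^{1−ε} + X^{3/5} Q^{1/5+ε}` … Choosing `Q = X^{1/3−ε}` … error terms of `O(X^{2/3+ε})`").
[cite: BhargavaTaniguchiThorne2023, §5 (displays (20)–(21) and the estimates of E₁, E₂, E₃ with Q = X^{1/3−ε})] -/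
theorem abs_sum_moebius_nonFundCount_sub_le {s : ℤ} (hs : s = 1 ∨ s = -1) {A : ℝ}
    (hL : LandauShintaniData s A) (hU : btt_uniformity_sqDvd) :
    ∃ K : ℝ, ∀ ε : ℝ, 0 < ε → ∃ C : ℝ, ∀ X : ℕ, 1 ≤ X →
      |(∑ q ∈ Finset.Icc 1 X, ((μ q : ℤ) : ℝ) * nonFundCount s q X) - A * X - K * (X : ℝ) ^ ((5 : ℝ) / 6)|
        ≤ C * (X : ℝ) ^ ((2 : ℝ) / 3 + ε) := by
  obtain ⟨r₁, r₂, hR1, hSum, hR2, hLan⟩ := hL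
  refine ⟨∑' q, ((μ q : ℤ) : ℝ) * r₂ q, fun ε hε => ?_⟩
  -- the working exponent `δ`: `2δ ≤ ε`, `δ ≤ 1/30`
  set δ : ℝ := min ε (1 / 15) / 2 with hδ
  have hδ0 : 0 < δ := by rw [hδ]; positivity
  have hδε : 2 * δ ≤ ε := by rw [hδ]; linarith [min_le_left ε (1 / 15)]
  have hδ30 : δ ≤ 1 / 30 := by rw [hδ]; linarith [min_le_right ε (1 / 15)]
  -- constants
  obtain ⟨C₁', hC₁'⟩ := hR1 δ hδ0
  obtain ⟨C₂', hC₂'⟩ := hR2 δ hδ0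
  obtain ⟨C_L', hC_L'⟩ := hLan δ hδ0
  obtain ⟨C_U', hC_U'⟩ := exists_nonFundCount_le hU
  obtain ⟨C₆, hC₆0, hC₆⟩ := pow_card_primeFactors_le (by norm_num : (1 : ℝ) ≤ 6) hδ0
  set C₁ := max C₁' 0 with hC₁
  set C₂ := max C₂' 0 with hC₂
  set C_L := max C_L' 0 with hCL
  set C_U := max C_U' 0 with hCU
  have hC₁r : ∀ q : ℕ, Squarefree q → |r₁ q| ≤ C₁ * (q : ℝ) ^ (-(2 - δ)) := fun q hq =>
    (hC₁' q hq).trans (by rw [show -(2 - δ) = -2 + δ by ring]; gcongr; exact le_max_left _ _)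
  have hC₂r : ∀ q : ℕ, Squarefree q → |r₂ q| ≤ C₂ * (q : ℝ) ^ (-(5 / 3 - δ)) := fun q hq =>
    (hC₂' q hq).trans (by rw [show -((5 : ℝ) / 3 - δ) = -(5 : ℝ) / 3 + δ by ring]; gcongr; exact le_max_left _ _)
  have hCLr : ∀ X : ℕ, 1 ≤ X → ∀ Q₁ : ℕ, 1 ≤ Q₁ → (Q₁ : ℝ) ≤ (X : ℝ) ^ ((1 : ℝ) / 3 - δ) →
      ∑ q ∈ (Finset.Ico Q₁ (2 * Q₁)).filter Squarefree,
          |nonFundCount s q X - r₁ q * X - r₂ q * (X : ℝ) ^ ((5 : ℝ) / 6)|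
        ≤ C_L * (X : ℝ) ^ ((3 : ℝ) / 5 + δ) * (Q₁ : ℝ) ^ ((1 : ℝ) / 5) := fun X hX Q₁ hQ₁ hQ =>
    (hC_L' X hX Q₁ hQ₁ hQ).trans (by gcongr; exact le_max_left _ _)
  have hCUr : ∀ q : ℕ, Squarefree q → ∀ X : ℕ, nonFundCount s q X ≤ C_U * 6 ^ q.primeFactors.card * X / (q : ℝ) ^ 2 :=
    fun q hq X => (hC_U' q hq s hs X).trans (by gcongr; exact le_max_left _ _)
  refine ⟨16 * C_L + 4 * C₁ + 3 * C₂ + 4 * C_U * C₆, fun X hX => ?_⟩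
  have hX1 : (1 : ℝ) ≤ X := by exact_mod_cast hX
  have hX0 : (0 : ℝ) < X := by positivity
  -- `Q = 2^J ≤ Y = X^{1/3-δ} < 2^{J+1} = M`
  set Y : ℝ := (X : ℝ) ^ ((1 : ℝ) / 3 - δ) with hY
  have hY1 : 1 ≤ Y := Real.one_le_rpow hX1 (by linarith)
  have hY0 : 0 < Y := by linarith
  obtain ⟨J, hJY, hYJ⟩ := exists_two_pow_le_lt hY1
  set M : ℕ := 2 ^ (J + 1) with hM
  have hMY : Y ≤ (M : ℝ) := by rw [hM]; push_cast; exact hYJ.le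
  have hM1 : 1 ≤ M := Nat.one_le_two_pow
  have hM0 : (0 : ℝ) < M := by positivity
  have hQM : 2 ^ J < M := by rw [hM]; exact Nat.pow_lt_pow_right (by norm_num) (by omega)
  -- abbreviations
  set N : ℕ → ℝ := fun q => nonFundCount s q X with hN
  set m : ℕ → ℝ := fun q => ((μ q : ℤ) : ℝ) with hm
  -- Step 0: `Σ_{q ≤ X} = Σ_{q < M} + Σ_{M ≤ q ≤ X}` (terms `q > X` vanish)
  have hsplit : ∑ q ∈ Finset.Icc 1 X, m q * N q =
      ∑ q ∈ Finset.Ico 1 M, m q * N q + ∑ q ∈ Finset.Icc 1 X \ Finset.Ico 1 M, m q * N q := by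
    have h := Finset.sum_sdiff_sub_sum_sdiff (s₁ := Finset.Icc 1 X) (s₂ := Finset.Ico 1 M) (f := fun q => m q * N q)
    have hzero : ∑ q ∈ Finset.Ico 1 M \ Finset.Icc 1 X, m q * N q = 0 := by
      refine Finset.sum_eq_zero fun q hq => ?_
      rw [Finset.mem_sdiff, Finset.mem_Ico, Finset.mem_Icc] at hq
      exact moebius_mul_nonFundCount_eq_zero_of_lt hs (by omega)
    rw [hzero] at h
    linarith
  -- Step 5 (`E₃`): the tail `M ≤ q ≤ X`
  have hE3 : |∑ q ∈ Finset.Icc 1 X \ Finset.Ico 1 M, m q * N q| ≤ 4 * C_U * C₆ * (X : ℝ) ^ ((2 : ℝ) / 3 + 2 * δ) := by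
    have hsub : Finset.Icc 1 X \ Finset.Ico 1 M ⊆ Finset.Icc M X := by
      intro q hq
      rw [Finset.mem_sdiff, Finset.mem_Icc, Finset.mem_Ico] at hq
      rw [Finset.mem_Icc]; omega
    calc |∑ q ∈ Finset.Icc 1 X \ Finset.Ico 1 M, m q * N q|
        ≤ ∑ q ∈ Finset.Icc 1 X \ Finset.Ico 1 M, |m q * N q| := Finset.abs_sum_le_sum_abs _ _
      _ ≤ ∑ q ∈ Finset.Icc M X, |m q * N q| := Finset.sum_le_sum_of_subset_of_nonneg hsub fun _ _ _ => abs_nonneg _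
      _ ≤ C_U * C₆ * X * ∑ q ∈ Finset.Ioc (2 ^ J) X, (q : ℝ) ^ (-(2 - δ)) :=
          sum_Icc_abs_moebius_nonFundCount_le (le_max_right _ _) hCUr hC₆ hQM X
      _ ≤ C_U * C₆ * X * (((2 ^ J : ℕ) : ℝ) ^ (1 - (2 - δ)) / ((2 - δ) - 1)) := by
          refine mul_le_mul_of_nonneg_left (Sieve.GPY.sum_Ioc_rpow_neg_le Nat.one_le_two_pow (by linarith)) ?_
          exact mul_nonneg (mul_nonneg (le_max_right _ _) hC₆0.le) hX0.le
      _ ≤ C_U * C₆ * X * (2 * (2 * (M : ℝ) ^ (1 - (2 - δ)))) := by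
          refine mul_le_mul_of_nonneg_left ?_ (mul_nonneg (mul_nonneg (le_max_right _ _) hC₆0.le) hX0.le)
          rw [div_eq_mul_inv]
          have hinv : ((2 - δ) - 1)⁻¹ ≤ (2 : ℝ) := by
            rw [inv_le_comm₀ (by linarith) (by norm_num)]; linarith
          have hQ : ((2 ^ J : ℕ) : ℝ) ^ (1 - (2 - δ)) ≤ 2 * (M : ℝ) ^ (1 - (2 - δ)) := by
            have h2Q : (M : ℝ) = 2 * ((2 ^ J : ℕ) : ℝ) := by rw [hM]; push_cast; ring
            rw [h2Q, Real.mul_rpow (by norm_num) (by positivity)]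
            have h2 : (1 : ℝ) ≤ 2 * (2 : ℝ) ^ (1 - (2 - δ)) := by
              rw [show (1 : ℝ) - (2 - δ) = δ - 1 by ring, Real.rpow_sub (by norm_num : (0:ℝ) < 2), Real.rpow_one]
              rw [mul_div_assoc', le_div_iff₀ (by norm_num : (0:ℝ) < 2)]
              have : (1 : ℝ) ≤ (2 : ℝ) ^ δ := Real.one_le_rpow (by norm_num) hδ0.le
              linarith
            calc ((2 ^ J : ℕ) : ℝ) ^ (1 - (2 - δ)) = 1 * ((2 ^ J : ℕ) : ℝ) ^ (1 - (2 - δ)) := (one_mul _).symm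
              _ ≤ (2 * (2 : ℝ) ^ (1 - (2 - δ))) * ((2 ^ J : ℕ) : ℝ) ^ (1 - (2 - δ)) :=
                  mul_le_mul_of_nonneg_right h2 (by positivity)
              _ = 2 * ((2 : ℝ) ^ (1 - (2 - δ)) * ((2 ^ J : ℕ) : ℝ) ^ (1 - (2 - δ))) := by ring
          calc ((2 ^ J : ℕ) : ℝ) ^ (1 - (2 - δ)) * ((2 - δ) - 1)⁻¹ ≤ (2 * (M : ℝ) ^ (1 - (2 - δ))) * 2 :=
                mul_le_mul hQ hinv (inv_nonneg.mpr (by linarith)) (by positivity)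
            _ = 2 * (2 * (M : ℝ) ^ (1 - (2 - δ))) := by ring
      _ = 4 * C_U * C₆ * (X * (M : ℝ) ^ (1 - (2 - δ))) := by ring
      _ ≤ 4 * C_U * C₆ * (X : ℝ) ^ ((2 : ℝ) / 3 + 2 * δ) := by
          refine mul_le_mul_of_nonneg_left (mul_rpow_neg_le_of_le hX1 hδ0.le hδ30 hMY) ?_
          exact mul_nonneg (mul_nonneg (by norm_num) (le_max_right _ _)) hC₆0.le
  -- Step 2 (`E₂`): the Landau error on `q < M`
  have hE2 : |∑ q ∈ Finset.Ico 1 M, m q * (N q - r₁ q * X - r₂ q * (X : ℝ) ^ ((5 : ℝ) / 6))|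
      ≤ 16 * C_L * (X : ℝ) ^ ((2 : ℝ) / 3 + 2 * δ) := by
    calc |∑ q ∈ Finset.Ico 1 M, m q * (N q - r₁ q * X - r₂ q * (X : ℝ) ^ ((5 : ℝ) / 6))|
        ≤ ∑ q ∈ Finset.Ico 1 M, |m q * (N q - r₁ q * X - r₂ q * (X : ℝ) ^ ((5 : ℝ) / 6))| := Finset.abs_sum_le_sum_abs _ _
      _ ≤ ∑ q ∈ (Finset.Ico 1 M).filter Squarefree, |N q - r₁ q * X - r₂ q * (X : ℝ) ^ ((5 : ℝ) / 6)| := by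
          rw [Finset.sum_filter]
          refine Finset.sum_le_sum fun q _ => ?_
          split_ifs with hq
          · rw [abs_mul]
            have hm1 : |m q| ≤ 1 := by
              show |((μ q : ℤ) : ℝ)| ≤ 1
              exact_mod_cast ArithmeticFunction.abs_moebius_le_one
            calc |m q| * _ ≤ 1 * _ := mul_le_mul_of_nonneg_right hm1 (abs_nonneg _)
              _ = _ := one_mul _
          · rw [hm]; simp only [ArithmeticFunction.moebius_eq_zero_of_not_squarefree hq, Int.cast_zero, zero_mul, abs_zero]; rfl
      _ ≤ 16 * C_L * (X : ℝ) ^ ((3 : ℝ) / 5 + δ) * ((2 : ℝ) ^ J) ^ ((1 : ℝ) / 5) :=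
          sum_dyadic_landau_le (le_max_right _ _) hCLr hX hJY
      _ = 16 * C_L * ((X : ℝ) ^ ((3 : ℝ) / 5 + δ) * ((2 : ℝ) ^ J) ^ ((1 : ℝ) / 5)) := by ring
      _ ≤ 16 * C_L * (X : ℝ) ^ ((2 : ℝ) / 3 + 2 * δ) :=
          mul_le_mul_of_nonneg_left (rpow_mul_two_pow_rpow_le hX1 hδ0.le hJY) (mul_nonneg (by norm_num) (le_max_right _ _))
  -- Steps 3–4 (`E₁`): completing the residue sums
  have hE1a : |(X : ℝ) * ∑ q ∈ Finset.Ico 1 M, m q * r₁ q - A * X| ≤ 4 * C₁ * (X : ℝ) ^ ((2 : ℝ) / 3 + 2 * δ) := by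
    have h := abs_sum_Ico_moebius_mul_sub_tsum_le (a := 2 - δ) (by linarith) (le_max_right _ _) hC₁r hM1
    rw [hSum.tsum_eq] at h
    calc |(X : ℝ) * ∑ q ∈ Finset.Ico 1 M, m q * r₁ q - A * X|
        = X * |∑ q ∈ Finset.Ico 1 M, m q * r₁ q - A| := by
          rw [← abs_of_pos hX0, ← abs_mul, abs_of_pos hX0]; ring_nf
      _ ≤ X * (C₁ * ((2 - δ) / ((2 - δ) - 1)) * (M : ℝ) ^ (1 - (2 - δ))) := mul_le_mul_of_nonneg_left h hX0.le
      _ ≤ X * (C₁ * 4 * (M : ℝ) ^ (1 - (2 - δ))) := by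
          refine mul_le_mul_of_nonneg_left (mul_le_mul_of_nonneg_right ?_ (by positivity)) hX0.le
          refine mul_le_mul_of_nonneg_left ?_ (le_max_right _ _)
          rw [div_le_iff₀ (by linarith)]; linarith
      _ = 4 * C₁ * (X * (M : ℝ) ^ (1 - (2 - δ))) := by ring
      _ ≤ 4 * C₁ * (X : ℝ) ^ ((2 : ℝ) / 3 + 2 * δ) :=
          mul_le_mul_of_nonneg_left (mul_rpow_neg_le_of_le hX1 hδ0.le hδ30 hMY) (mul_nonneg (by norm_num) (le_max_right _ _))
  have hE1b : |(X : ℝ) ^ ((5 : ℝ) / 6) * ∑ q ∈ Finset.Ico 1 M, m q * r₂ q - (∑' q, m q * r₂ q) * (X : ℝ) ^ ((5 : ℝ) / 6)|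
      ≤ 3 * C₂ * (X : ℝ) ^ ((2 : ℝ) / 3 + 2 * δ) := by
    have h := abs_sum_Ico_moebius_mul_sub_tsum_le (a := 5 / 3 - δ) (by linarith) (le_max_right _ _) hC₂r hM1
    have hX56 : (0 : ℝ) < (X : ℝ) ^ ((5 : ℝ) / 6) := by positivity
    calc |(X : ℝ) ^ ((5 : ℝ) / 6) * ∑ q ∈ Finset.Ico 1 M, m q * r₂ q - (∑' q, m q * r₂ q) * (X : ℝ) ^ ((5 : ℝ) / 6)|
        = (X : ℝ) ^ ((5 : ℝ) / 6) * |∑ q ∈ Finset.Ico 1 M, m q * r₂ q - ∑' q, m q * r₂ q| := by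
          rw [← abs_of_pos hX56, ← abs_mul, abs_of_pos hX56]; ring_nf
      _ ≤ (X : ℝ) ^ ((5 : ℝ) / 6) * (C₂ * ((5 / 3 - δ) / ((5 / 3 - δ) - 1)) * (M : ℝ) ^ (1 - (5 / 3 - δ))) :=
          mul_le_mul_of_nonneg_left h hX56.le
      _ ≤ (X : ℝ) ^ ((5 : ℝ) / 6) * (C₂ * 3 * (M : ℝ) ^ (1 - (5 / 3 - δ))) := by
          refine mul_le_mul_of_nonneg_left (mul_le_mul_of_nonneg_right ?_ (by positivity)) hX56.le
          refine mul_le_mul_of_nonneg_left ?_ (le_max_right _ _)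
          rw [div_le_iff₀ (by linarith)]; linarith
      _ = 3 * C₂ * ((X : ℝ) ^ ((5 : ℝ) / 6) * (M : ℝ) ^ (1 - (5 / 3 - δ))) := by ring
      _ ≤ 3 * C₂ * (X : ℝ) ^ ((2 : ℝ) / 3 + 2 * δ) :=
          mul_le_mul_of_nonneg_left (rpow_mul_rpow_neg_le_of_le hX1 hδ0.le hδ30 hMY) (mul_nonneg (by norm_num) (le_max_right _ _))
  -- assembly
  have hdecomp : (∑ q ∈ Finset.Icc 1 X, m q * N q) - A * X - (∑' q, m q * r₂ q) * (X : ℝ) ^ ((5 : ℝ) / 6) =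
      (∑ q ∈ Finset.Ico 1 M, m q * (N q - r₁ q * X - r₂ q * (X : ℝ) ^ ((5 : ℝ) / 6))) +
      ((X : ℝ) * ∑ q ∈ Finset.Ico 1 M, m q * r₁ q - A * X) +
      ((X : ℝ) ^ ((5 : ℝ) / 6) * ∑ q ∈ Finset.Ico 1 M, m q * r₂ q - (∑' q, m q * r₂ q) * (X : ℝ) ^ ((5 : ℝ) / 6)) +
      ∑ q ∈ Finset.Icc 1 X \ Finset.Ico 1 M, m q * N q := by
    rw [hsplit]
    simp only [mul_sub, Finset.sum_sub_distrib, Finset.mul_sum]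
    ring_nf
  have hXe : (X : ℝ) ^ ((2 : ℝ) / 3 + 2 * δ) ≤ (X : ℝ) ^ ((2 : ℝ) / 3 + ε) :=
    Real.rpow_le_rpow_of_exponent_le hX1 (by linarith)
  have hconst : 0 ≤ 16 * C_L + 4 * C₁ + 3 * C₂ + 4 * C_U * C₆ := by
    have := le_max_right C_L' 0; have := le_max_right C₁' 0; have := le_max_right C₂' 0; have := le_max_right C_U' 0
    positivity
  calc |(∑ q ∈ Finset.Icc 1 X, m q * N q) - A * X - (∑' q, m q * r₂ q) * (X : ℝ) ^ ((5 : ℝ) / 6)|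
      ≤ |∑ q ∈ Finset.Ico 1 M, m q * (N q - r₁ q * X - r₂ q * (X : ℝ) ^ ((5 : ℝ) / 6))| +
        |(X : ℝ) * ∑ q ∈ Finset.Ico 1 M, m q * r₁ q - A * X| +
        |(X : ℝ) ^ ((5 : ℝ) / 6) * ∑ q ∈ Finset.Ico 1 M, m q * r₂ q - (∑' q, m q * r₂ q) * (X : ℝ) ^ ((5 : ℝ) / 6)| +
        |∑ q ∈ Finset.Icc 1 X \ Finset.Ico 1 M, m q * N q| := by
          rw [hdecomp]
          exact (abs_add_le _ _).trans (add_le_add ((abs_add_le _ _).trans (add_le_add (abs_add_le _ _) le_rfl)) le_rfl)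
    _ ≤ 16 * C_L * (X : ℝ) ^ ((2 : ℝ) / 3 + 2 * δ) + 4 * C₁ * (X : ℝ) ^ ((2 : ℝ) / 3 + 2 * δ) +
        3 * C₂ * (X : ℝ) ^ ((2 : ℝ) / 3 + 2 * δ) + 4 * C_U * C₆ * (X : ℝ) ^ ((2 : ℝ) / 3 + 2 * δ) :=
          add_le_add (add_le_add (add_le_add hE2 hE1a) hE1b) hE3
    _ = (16 * C_L + 4 * C₁ + 3 * C₂ + 4 * C_U * C₆) * (X : ℝ) ^ ((2 : ℝ) / 3 + 2 * δ) := by ring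
    _ ≤ (16 * C_L + 4 * C₁ + 3 * C₂ + 4 * C_U * C₆) * (X : ℝ) ^ ((2 : ℝ) / 3 + ε) :=
          mul_le_mul_of_nonneg_left hXe hconst

/-! ### (3) from the analytic input and the uniformity estimate -/

/-- **BTT (3) ⟸ the Landau–Shintani input (both signs) + the uniformity estimate.** With
`N⁻_{3,fund}(X) = Σ_q μ(q) N⁻(X, Ψ_{q²}) − ½ #negFundDiscrs X` and
`N⁺_{3,fund}(X) = Σ_q μ(q) N⁺(X, Ψ_{q²}) − ½ #posFundDiscrs X − [1<X]·a(1)` ((20) + Prop. 4.3 per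
discriminant), `#{0 < ±D < X fund.} = (3/π²)X + O(√X)` (Prop. 4.2) and the core bound: the inputs
`LandauShintaniData (−1) (3/π²)`, `LandauShintaniData 1 (2/π²)` (the constants (21):
`(α^± + β)(6/π²)²`) and `btt_uniformity_sqDvd` (Prop. 4.5) prove `btt_fundCubicFieldCount_sum`
(main terms `3/π² − 3/(2π²) = 3/(2π²)` and `2/π² − 3/(2π²) = 1/(2π²)`).
[cite: BhargavaTaniguchiThorne2023, §5 ("we obtain error terms of O(X^{2/3+ε}) … in (3), which is equivalent to Theorem 1.2")] -/
theorem btt_fundCubicFieldCount_sum_of_landauShintani (hneg : LandauShintaniData (-1) (3 / Real.pi ^ 2))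
    (hpos : LandauShintaniData 1 (2 / Real.pi ^ 2)) (hU : btt_uniformity_sqDvd) : btt_fundCubicFieldCount_sum := by
  constructor
  · obtain ⟨K, hK⟩ := abs_sum_moebius_nonFundCount_sub_le (Or.inr rfl) hneg hU
    refine ⟨K, fun ε hε => ?_⟩
    obtain ⟨C, hC⟩ := hK ε hε
    refine ⟨C + 4, fun X hX => ?_⟩
    have hX1 : (1 : ℝ) ≤ X := by exact_mod_cast hX
    obtain ⟨hsqrt, h1⟩ := sqrt_le_rpow_two_thirds hX1 hε.le
    have hW : ∑ D ∈ negFundDiscrs X, (cubicFieldCountOfDisc D : ℝ) =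
        (∑ q ∈ Finset.Icc 1 X, ((μ q : ℤ) : ℝ) * nonFundCount (-1) q X) - ((negFundDiscrs X).card : ℝ) / 2 := by
      rw [sum_moebius_mul_nonFundCount (Or.inr rfl), sum_locFund_shintaniCoeffReal_neg]; ring
    have hcard := abs_card_negFundDiscrs_sub_le X
    have hmain := hC X hX
    rw [hW]
    have key : (∑ q ∈ Finset.Icc 1 X, ((μ q : ℤ) : ℝ) * nonFundCount (-1) q X) - ((negFundDiscrs X).card : ℝ) / 2
        - 3 / (2 * Real.pi ^ 2) * X - K * (X : ℝ) ^ ((5 : ℝ) / 6) =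
        ((∑ q ∈ Finset.Icc 1 X, ((μ q : ℤ) : ℝ) * nonFundCount (-1) q X) - 3 / Real.pi ^ 2 * X - K * (X : ℝ) ^ ((5 : ℝ) / 6))
        - (((negFundDiscrs X).card : ℝ) - 3 / Real.pi ^ 2 * X) / 2 := by
      field_simp
      ring
    rw [key]
    calc |((∑ q ∈ Finset.Icc 1 X, ((μ q : ℤ) : ℝ) * nonFundCount (-1) q X) - 3 / Real.pi ^ 2 * X - K * (X : ℝ) ^ ((5 : ℝ) / 6))
          - (((negFundDiscrs X).card : ℝ) - 3 / Real.pi ^ 2 * X) / 2|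
        ≤ |(∑ q ∈ Finset.Icc 1 X, ((μ q : ℤ) : ℝ) * nonFundCount (-1) q X) - 3 / Real.pi ^ 2 * X - K * (X : ℝ) ^ ((5 : ℝ) / 6)|
          + |(((negFundDiscrs X).card : ℝ) - 3 / Real.pi ^ 2 * X) / 2| := abs_sub _ _
      _ ≤ C * (X : ℝ) ^ ((2 : ℝ) / 3 + ε) + 4 * Real.sqrt X := by
          refine add_le_add hmain ?_
          rw [abs_div, abs_two]
          linarith
      _ ≤ C * (X : ℝ) ^ ((2 : ℝ) / 3 + ε) + 4 * (X : ℝ) ^ ((2 : ℝ) / 3 + ε) := by linarith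
      _ = (C + 4) * (X : ℝ) ^ ((2 : ℝ) / 3 + ε) := by ring
  · obtain ⟨K, hK⟩ := abs_sum_moebius_nonFundCount_sub_le (Or.inl rfl) hpos hU
    refine ⟨K, fun ε hε => ?_⟩
    obtain ⟨C, hC⟩ := hK ε hε
    refine ⟨C + 4 + shintaniCoeffReal 1, fun X hX => ?_⟩
    have hX1 : (1 : ℝ) ≤ X := by exact_mod_cast hX
    obtain ⟨hsqrt, h1⟩ := sqrt_le_rpow_two_thirds hX1 hε.le
    have ha1 : 0 ≤ shintaniCoeffReal 1 := shintaniCoeffReal_nonneg 1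
    have hW : ∑ D ∈ posFundDiscrs X, (cubicFieldCountOfDisc D : ℝ) =
        (∑ q ∈ Finset.Icc 1 X, ((μ q : ℤ) : ℝ) * nonFundCount 1 q X) - ((posFundDiscrs X).card : ℝ) / 2
          - (if 1 < X then shintaniCoeffReal 1 else 0) := by
      rw [sum_moebius_mul_nonFundCount (Or.inl rfl), sum_locFund_shintaniCoeffReal_pos]; ring
    have hcard := abs_card_posFundDiscrs_sub_le X
    have hmain := hC X hX
    have hextra : |(if 1 < X then shintaniCoeffReal 1 else 0)| ≤ shintaniCoeffReal 1 := by
      split_ifs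
      · exact (abs_of_nonneg ha1).le
      · rw [abs_zero]; exact ha1
    rw [hW]
    have key : (∑ q ∈ Finset.Icc 1 X, ((μ q : ℤ) : ℝ) * nonFundCount 1 q X) - ((posFundDiscrs X).card : ℝ) / 2
        - (if 1 < X then shintaniCoeffReal 1 else 0) - 1 / (2 * Real.pi ^ 2) * X - K * (X : ℝ) ^ ((5 : ℝ) / 6) =
        ((∑ q ∈ Finset.Icc 1 X, ((μ q : ℤ) : ℝ) * nonFundCount 1 q X) - 2 / Real.pi ^ 2 * X - K * (X : ℝ) ^ ((5 : ℝ) / 6))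
        - (((posFundDiscrs X).card : ℝ) - 3 / Real.pi ^ 2 * X) / 2 - (if 1 < X then shintaniCoeffReal 1 else 0) := by
      field_simp
      ring
    rw [key]
    calc |((∑ q ∈ Finset.Icc 1 X, ((μ q : ℤ) : ℝ) * nonFundCount 1 q X) - 2 / Real.pi ^ 2 * X - K * (X : ℝ) ^ ((5 : ℝ) / 6))
          - (((posFundDiscrs X).card : ℝ) - 3 / Real.pi ^ 2 * X) / 2 - (if 1 < X then shintaniCoeffReal 1 else 0)|
        ≤ |(∑ q ∈ Finset.Icc 1 X, ((μ q : ℤ) : ℝ) * nonFundCount 1 q X) - 2 / Real.pi ^ 2 * X - K * (X : ℝ) ^ ((5 : ℝ) / 6)|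
          + |(((posFundDiscrs X).card : ℝ) - 3 / Real.pi ^ 2 * X) / 2| + |(if 1 < X then shintaniCoeffReal 1 else 0)| :=
          (abs_sub _ _).trans (add_le_add (abs_sub _ _) le_rfl)
      _ ≤ C * (X : ℝ) ^ ((2 : ℝ) / 3 + ε) + 4 * Real.sqrt X + shintaniCoeffReal 1 := by
          refine add_le_add (add_le_add hmain ?_) hextra
          rw [abs_div, abs_two]
          linarith
      _ ≤ C * (X : ℝ) ^ ((2 : ℝ) / 3 + ε) + 4 * (X : ℝ) ^ ((2 : ℝ) / 3 + ε) + shintaniCoeffReal 1 * (X : ℝ) ^ ((2 : ℝ) / 3 + ε) := by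
          nlinarith
      _ = (C + 4 + shintaniCoeffReal 1) * (X : ℝ) ^ ((2 : ℝ) / 3 + ε) := by ring

/-! ### Theorem 1.2 from the same inputs and the class-field-theory dictionary -/

/-- **BTT Thm 1.2 (`btt_threeTorsion_sum`) ⟸ the CFT dictionary + the Landau–Shintani input (both
signs) + the uniformity estimate**: the complete chain of the tree's decomposition
(`ThreeTorsionMeanDecomposition.btt_threeTorsion_sum_holds_of` with
`btt_fundCubicFieldCount_sum_of_landauShintani`) — "we obtain error terms of `O(X^{2/3+ε})` … in (3),
which is equivalent to Theorem 1.2". [cite: BhargavaTaniguchiThorne2023, §5 (end of the direct proof: (3) ⟺ Thm 1.2)] -/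
theorem btt_threeTorsion_sum_of_landauShintani (hdict : threeTorsion_eq_two_mul_cubicFieldCountOfDisc_add_one)
    (hneg : LandauShintaniData (-1) (3 / Real.pi ^ 2)) (hpos : LandauShintaniData 1 (2 / Real.pi ^ 2))
    (hU : btt_uniformity_sqDvd) : btt_threeTorsion_sum :=
  btt_threeTorsion_sum_holds_of hdict (btt_fundCubicFieldCount_sum_of_landauShintani hneg hpos hU)

end Literature.NumberTheory.CubicFields

end
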